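import Summits.CriticalPhenomena.CardyFormulaZ2.Theorems.CardyIKTransportIKMixedBoxCrossingQuenchedTotalMass
import Summits.CriticalPhenomena.CardyFormulaZ2.Theorems.CardyIKTransportIKMixedBoxCrossingQuenchedCodeIff

/-!
# Stub `stub_quenchedMixture` — THE EXACT QUENCHED MIXTURE (M) of the line `defect-closure-exploration` v7 /
# ALT line `quenched-chain-fkg` (crux `IKMixedBoxCrossing`, stmt-CriticalPhenomena-5911)

Support file (`--supports stmt-CriticalPhenomena-5911`).  Vocabulary: `…QuenchedMixtureDefs` (`comps`, `compCells`,
`localCode`, `freeCells`, `patterns`, `chainW`, `quenchedW`, `envW`, `quenchedProb`, `QuenchedMixture`); component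
bookkeeping from the landed `…QuenchedTotalMass` (`TotalMass.*`) and the code structure `codeIff` (`…QuenchedCodeIff`).  Proves
`quenchedMixture : QuenchedMixture` (= the registered `stub_quenchedMixture`): for every pattern `S`, box `Λ` and family
`𝒜 ⊆ Λ.powerset`, `colourLaw S Λ {boxFill Λ white s | s ∈ 𝒜} = Σ_D Σ_{v ∈ patterns D} envW S Λ D · quenchedProb D Λ v 𝒜`.

PROOF, defect set `D ⊆ facesIn S Λ ⊆ innerVertices Λ` by defect set (`w_D = ρ^|D| (1−ρ)^{|V|−|D|}`, `V_K = localCode D K`).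
* LEFT (`card_completions`): by the landed product representation `stub_colourLawMixture` and the pivot count
  `card_filter_exists_completion`, the `D`-term is `w_D · 2^{-|Λ|} · 2^{|D|} · #{t ∈ 𝒜 | t is D-even}` (`boxFill_injOn`).
* RIGHT: the sum over `patterns D` of the product of the per-component chain weights FACTORISES over the components
  (`sum_patterns_prod`, Mathlib `Finset.prod_sum`); per component `Σ_{vK ∈ V_K ∖ {∅, K}} chainW = (|V_K| − 2)/|V_K| · [τ ∈ V_K]`
  (`sum_chainW`), and `|V_K| ≥ 3` (`two_lt_card_localCode`: `∅`, `K` and the column-parity STRIPE are codewords), so the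
  factors `(|V_K| − 2)⁻¹` of `envW` cancel; the product of the indicators `[t ∩ K ∈ V_K]` is `[t is D-even]` (landed
  `codeIff`, the product structure of the code).  So the `D`-term is `w_D · 2^{-|free|} Π_K |V_K|⁻¹ · #{t ∈ 𝒜 | D-even}`.
* THE CODE COUNT `2^|D| · 2^|free| · Π_K |V_K| = 2^|Λ|` (`two_pow_mul_codeCard`): the components' cell sets are pairwise
  disjoint and tile `Λ ∖ free` (landed `TotalMass.freeCells_union_biUnion_comps`), each defect face belongs to exactly one
  component (`card_eq_sum_card_faces`), and `2^{|D_K|} |V_K| = 2^{|K|}` is the landed RANK LEMMA in the volume `K`.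
-/

noncomputable section

namespace Summit.CriticalPhenomena.CardyFormulaZ2.Cruxes.IKMixedBoxCrossing.QuenchedChainFKG

open scoped Classical BigOperators ENNReal NNReal
open Finset MeasureTheory
open Literature.Probability.LatticeModels
open Summit.CriticalPhenomena.CardyFormulaZ2.Cruxes.IKMixedBoxCrossing.DefectClosureExploration (facesIn colourLaw maskDensity tIK)
open TotalMass (disjoint_of_mem_comps disjoint_freeCells_biUnion_comps freeCells_union_biUnion_comps empty_mem_localCode)
open CodeStructure (cellFace_subset_compCells compCells_mem_comps)

namespace QuenchedMixtureStub

/-! ## §1 The two counts of the component partition -/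

/-- CELL COUNT: `|Λ| = |free cells| + Σ_K |K|` for `D ⊆ innerVertices Λ` (the components tile `Λ ∖ free` disjointly). -/
theorem card_eq_card_freeCells_add {D Λ : Finset (Site 2)} (hD : D ⊆ innerVertices Λ) :
    Λ.card = (freeCells D Λ).card + ∑ K ∈ comps D, K.card := by
  rw [← congrArg Finset.card (freeCells_union_biUnion_comps hD),
    Finset.card_union_of_disjoint (disjoint_freeCells_biUnion_comps D Λ),
    Finset.card_biUnion (t := id) fun K hK K' hK' hne => disjoint_of_mem_comps hK hK' hne]
  rfl

/-- FACE COUNT: `|D| = Σ_K |{g ∈ D | cellFace g ⊆ K}|` (each defect face belongs to exactly one component). -/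
theorem card_eq_sum_card_faces (D : Finset (Site 2)) :
    D.card = ∑ K ∈ comps D, (D.filter fun g => cellFace g ⊆ K).card := by
  have hmaps : (↑D : Set (Site 2)).MapsTo (fun g => if h : g ∈ D then compCells D ⟨g, h⟩ else ∅) ↑(comps D) :=
    fun g hg => by
      have hg' : g ∈ D := hg
      simp only [dif_pos hg', Finset.mem_coe]
      exact compCells_mem_comps hg'
  rw [Finset.card_eq_sum_card_fiberwise hmaps]
  refine Finset.sum_congr rfl fun K hK => congrArg Finset.card (Finset.filter_congr fun g hg => ?_)
  simp only [dif_pos hg]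
  refine ⟨fun h => h ▸ cellFace_subset_compCells hg, fun h => by_contra fun hne => ?_⟩
  exact Finset.disjoint_left.1 (disjoint_of_mem_comps (compCells_mem_comps hg) hK hne)
    (cellFace_subset_compCells hg (self_mem_cellFace g)) (h (self_mem_cellFace g))

/-! ## §2 The local codes: rank and three distinguished codewords -/

/-- With a white boundary condition, the filling of `s ⊆ Λ` is the indicator of `s`. -/
theorem boxFill_white_eq {Λ s : Finset (Site 2)} (hs : s ⊆ Λ) :
    boxFill Λ (fun _ => false) s = fun x => decide (x ∈ s) := by
  funext x
  by_cases hx : x ∈ Λ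
  · exact boxFill_apply_of_mem _ _ hx
  · rw [boxFill_apply_of_not_mem _ _ hx]
    exact (decide_eq_false fun h => hx (hs h)).symm

/-- RANK of a local code: `2 ^ |{g ∈ D | cellFace g ⊆ K}| · |localCode D K| = 2 ^ |K|` (rank lemma in the volume `K`). -/
theorem two_pow_mul_card_localCode (D K : Finset (Site 2)) :
    2 ^ (D.filter fun g => cellFace g ⊆ K).card * (localCode D K).card = 2 ^ K.card := by
  have h : localCode D K = K.powerset.filter fun τ =>
      ∀ f ∈ D.filter (fun g => cellFace g ⊆ K), ¬ IsOddFace (boxFill K (fun _ => false) τ) f := by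
    unfold localCode
    refine Finset.filter_congr fun τ hτ => ?_
    rw [boxFill_white_eq (Finset.mem_powerset.1 hτ)]
    simp only [Finset.mem_filter, and_imp]
  rw [h]
  exact DefectClosureExploration.two_pow_mul_card_filter_even (fun _ => false) _ rfl
    fun g hg => mem_innerVertices_iff.2 (Finset.mem_filter.1 hg).2

/-- THE CODE COUNT: `2 ^ |D| · 2 ^ |free| · Π_K |localCode D K| = 2 ^ |Λ|` for `D ⊆ innerVertices Λ`. -/
theorem two_pow_mul_codeCard {D Λ : Finset (Site 2)} (hD : D ⊆ innerVertices Λ) :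
    2 ^ D.card * (2 ^ (freeCells D Λ).card * ∏ K ∈ comps D, (localCode D K).card) = 2 ^ Λ.card := by
  have h : ∏ K ∈ comps D, 2 ^ K.card =
      ∏ K ∈ comps D, 2 ^ (D.filter fun g => cellFace g ⊆ K).card * (localCode D K).card :=
    Finset.prod_congr rfl fun K _ => (two_pow_mul_card_localCode D K).symm
  rw [card_eq_card_freeCells_add hD, card_eq_sum_card_faces D, pow_add, ← Finset.prod_pow_eq_pow_sum,
    ← Finset.prod_pow_eq_pow_sum, h, Finset.prod_mul_distrib]
  ring

/-- The full cell set is a local codeword (a block inside `K` is all black, hence even). -/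
theorem self_mem_localCode (D K : Finset (Site 2)) : K ∈ localCode D K := by
  refine Finset.mem_filter.2 ⟨Finset.mem_powerset.2 (Finset.Subset.refl K), fun g _ hg => ?_⟩
  have h : ∀ x ∈ cellFace g, decide (x ∈ K) = true := fun x hx => decide_eq_true (hg hx)
  rw [isOddFace_iff_xor, h _ (mem_cellFace_iff.2 (Or.inl rfl)), h _ (mem_cellFace_iff.2 (Or.inr (Or.inl rfl))),
    h _ (mem_cellFace_iff.2 (Or.inr (Or.inr (Or.inl rfl)))), h _ (mem_cellFace_iff.2 (Or.inr (Or.inr (Or.inr rfl))))]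
  decide

/-- The columns of the cells `g + e₀`, `g + e₁`, `g + 1` of a face: `g 0 + 1`, `g 0`, `g 0 + 1`. -/
theorem cellFace_cols (g : Site 2) :
    (g + Pi.single 0 1 : Site 2) 0 = g 0 + 1 ∧ (g + Pi.single 1 1 : Site 2) 0 = g 0 ∧ (g + 1 : Site 2) 0 = g 0 + 1 :=
  ⟨by simp, by simp, by simp⟩

/-- The column-parity colouring (black = even column) has no odd face: a block has two cells in each column class. -/
theorem not_isOddFace_colParity (g : Site 2) : ¬ IsOddFace (fun x : Site 2 => decide (Even (x 0))) g := by
  obtain ⟨h0, h1, h2⟩ := cellFace_cols g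
  rw [isOddFace_iff_xor, h0, h1, h2]
  simp only [Int.even_add_one, decide_not]
  cases decide (Even (g 0)) <;> decide

/-- The column-parity STRIPE `{c ∈ K | c 0 even}` is a local codeword. -/
theorem stripe_mem_localCode (D K : Finset (Site 2)) : (K.filter fun c => Even (c 0)) ∈ localCode D K := by
  refine Finset.mem_filter.2 ⟨Finset.mem_powerset.2 (Finset.filter_subset _ K), fun g _ hg hodd => ?_⟩
  have key := DefectClosureExploration.isOddFace_congr (w := g)
    (σ := fun x => decide (x ∈ K.filter fun c => Even (c 0))) (σ' := fun x : Site 2 => decide (Even (x 0)))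
    fun x hx => by
      refine decide_eq_decide.2 ?_
      have h1 : x ∈ K.filter (fun c => Even (c 0)) ↔ Even (x 0) := by
        rw [Finset.mem_filter]
        exact ⟨fun h => h.2, fun h => ⟨hg hx, h⟩⟩
      exact h1.symm
  exact not_isOddFace_colParity g (key.2 hodd)

/-- A local code of a component has at least three words: `∅`, `K`, the stripe (a block has both column parities). -/
theorem two_lt_card_localCode {D : Finset (Site 2)} {K : Finset (Site 2)} (hK : K ∈ comps D) :
    2 < (localCode D K).card := by
  obtain ⟨⟨g, hg⟩, -, rfl⟩ := Finset.mem_image.1 hK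
  have hsub := cellFace_subset_compCells hg
  have hg0 : g ∈ compCells D ⟨g, hg⟩ := hsub (self_mem_cellFace _)
  have hg1 : g + Pi.single 0 1 ∈ compCells D ⟨g, hg⟩ := hsub (mem_cellFace_iff.2 (Or.inr (Or.inl rfl)))
  have hcol : (g + Pi.single 0 1 : Site 2) 0 = g 0 + 1 := (cellFace_cols g).1
  refine Finset.two_lt_card_iff.2 ⟨∅, compCells D ⟨g, hg⟩, (compCells D ⟨g, hg⟩).filter fun c => Even (c 0),
    empty_mem_localCode _ _, self_mem_localCode _ _, stripe_mem_localCode _ _,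
    fun h => (Finset.notMem_empty _ (h.symm ▸ hg0)), fun h => ?_, fun h => ?_⟩
  · rcases Int.even_or_odd (g 0) with he | ho
    · exact Finset.notMem_empty _ (h.symm ▸ Finset.mem_filter.2 ⟨hg0, he⟩)
    · refine Finset.notMem_empty (g + Pi.single 0 1) (h.symm ▸ Finset.mem_filter.2 ⟨hg1, ?_⟩)
      rw [hcol]; exact ho.add_one
  · rcases Int.even_or_odd (g 0) with he | ho
    · have := (h ▸ hg1 : g + Pi.single 0 1 ∈ (compCells D ⟨g, hg⟩).filter fun c => Even (c 0))
      rw [Finset.mem_filter, hcol] at this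
      exact Int.not_even_iff_odd.2 he.add_one this.2
    · have := (h ▸ hg0 : g ∈ (compCells D ⟨g, hg⟩).filter fun c => Even (c 0))
      exact Int.not_even_iff_odd.2 ho (Finset.mem_filter.1 this).2

/-! ## §3 Pattern sums: the per-component chain average and the factorisation over components -/

/-- THE PER-COMPONENT PATTERN SUM over `vK ∈ V ∖ {∅, K}` of the chain weights: `(|V| − 2)/|V| · [τ ∈ V]`. -/
theorem sum_chainW {V : Finset (Finset (Site 2))} {K : Finset (Site 2)} (h0 : ∅ ∈ V) (hK : K ∈ V)
    (h0K : (∅ : Finset (Site 2)) ≠ K) (τ : Finset (Site 2)) :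
    ∑ vK ∈ (V.erase ∅).erase K, chainW V.card K vK τ = ((V.card : ℝ) - 2) / V.card * if τ ∈ V then 1 else 0 := by
  have hKm : K ∈ V.erase ∅ := Finset.mem_erase.2 ⟨h0K.symm, hK⟩
  have h2 : 2 ≤ V.card := by
    have := Finset.card_erase_of_mem h0; have := Finset.card_pos.2 ⟨K, hKm⟩; omega
  have hcard : (((V.erase ∅).erase K).card : ℝ) = V.card - 2 := by
    rw [Finset.card_erase_of_mem hKm, Finset.card_erase_of_mem h0, Nat.sub_sub, Nat.cast_sub h2]
    norm_num
  by_cases hτ0 : τ = ∅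
  · subst hτ0
    have hterm : ∀ vK, chainW V.card K vK ∅ = 1 / V.card := fun vK => by simp [chainW]
    simp only [hterm, h0, if_true, Finset.sum_const, nsmul_eq_mul, hcard]
    ring
  by_cases hτK : τ = K
  · subst hτK
    have hterm : ∀ vK, chainW V.card τ vK τ = 1 / V.card := fun vK => by simp [chainW]
    simp only [hterm, hK, if_true, Finset.sum_const, nsmul_eq_mul, hcard]
    ring
  · have hterm : ∀ vK, chainW V.card K vK τ = if τ = vK then ((V.card : ℝ) - 2) / V.card else 0 := fun vK => by
      simp [chainW, hτ0, hτK]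
    simp only [hterm, Finset.sum_ite_eq]
    have hiff : τ ∈ (V.erase ∅).erase K ↔ τ ∈ V := by simp [Finset.mem_erase, hτ0, hτK]
    by_cases hτV : τ ∈ V
    · rw [if_pos (hiff.2 hτV), if_pos hτV, mul_one]
    · rw [if_neg (fun h => hτV (hiff.1 h)), if_neg hτV, mul_zero]

/-- FACTORISATION OVER COMPONENTS of a pattern sum of per-component products (`Finset.prod_sum`, `Finset.sum_image`). -/
theorem sum_patterns_prod (D : Finset (Site 2)) (F : Finset (Site 2) → Finset (Site 2) → ℝ) :
    ∑ v ∈ patterns D, ∏ K ∈ comps D, F K (v K) =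
      ∏ K ∈ comps D, ∑ vK ∈ ((localCode D K).erase ∅).erase K, F K vK := by
  unfold patterns
  rw [Finset.sum_image, Finset.prod_sum]
  · refine Finset.sum_congr rfl fun f _ => ?_
    rw [← Finset.prod_attach (comps D)]
    exact Finset.prod_congr rfl fun K _ => by simp only [dif_pos K.2]
  · intro f _ f' _ h
    funext K hK
    have := congrFun h K
    simpa only [dif_pos hK] using this

/-- THE QUENCHED SUM OVER PATTERNS for a black set `s ⊆ Λ`:
`Π_K (|V_K| − 2)⁻¹ · Σ_{v ∈ patterns D} quenchedW = 2^{-|free|} · [s is D-even] · Π_K |V_K|⁻¹`. -/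
theorem sum_patterns_quenchedW {D Λ : Finset (Site 2)} (hD : D ⊆ innerVertices Λ) {s : Finset (Site 2)} (hs : s ⊆ Λ) :
    (∏ K ∈ comps D, 1 / (((localCode D K).card : ℝ) - 2)) * ∑ v ∈ patterns D, quenchedW D Λ v s =
      ((1 : ℝ) / 2) ^ (freeCells D Λ).card *
        ((if ∀ g ∈ D, ¬ IsOddFace (fun x => decide (x ∈ s)) g then 1 else 0) *
          ∏ K ∈ comps D, 1 / ((localCode D K).card : ℝ)) := by
  simp only [quenchedW, if_pos hs]
  rw [← Finset.mul_sum, sum_patterns_prod D fun K vK => chainW (localCode D K).card K vK (s ∩ K),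
    mul_left_comm, ← Finset.prod_mul_distrib]
  congr 1
  have hK : ∀ K ∈ comps D, 1 / (((localCode D K).card : ℝ) - 2) *
      ∑ vK ∈ ((localCode D K).erase ∅).erase K, chainW (localCode D K).card K vK (s ∩ K) =
        (if s ∩ K ∈ localCode D K then 1 else 0) * (1 / ((localCode D K).card : ℝ)) := fun K hK => by
    have hne : (∅ : Finset (Site 2)) ≠ K := by
      rintro rfl
      obtain ⟨⟨g, hg⟩, -, h0⟩ := Finset.mem_image.1 hK
      exact Finset.notMem_empty _ (h0 ▸ cellFace_subset_compCells hg (self_mem_cellFace _))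
    rw [sum_chainW (empty_mem_localCode D K) (self_mem_localCode D K) hne]
    have h3 : ((localCode D K).card : ℝ) - 2 ≠ 0 := by
      have : (2 : ℝ) < (localCode D K).card := by exact_mod_cast two_lt_card_localCode hK
      linarith
    field_simp
  rw [Finset.prod_congr rfl hK, Finset.prod_mul_distrib, Finset.prod_boole]
  congr 2
  exact propext (codeIff D Λ hD s hs).symm

/-! ## §4 The two sides of (M), defect set by defect set, and the assembly -/

/-- The event `{boxFill Λ white s | s ∈ 𝒜}` is a finite, hence measurable, set of colourings. -/
theorem measurableSet_image (Λ : Finset (Site 2)) (𝒜 : Finset (Finset (Site 2))) :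
    MeasurableSet ((fun s => boxFill Λ (fun _ => false) s) '' (↑𝒜 : Set (Finset (Site 2)))) :=
  (𝒜.finite_toSet.image _).measurableSet

/-- LEFT SIDE: the fillings whose `D`-even pivot completion is `boxFill` of a member of `𝒜 ⊆ Λ.powerset` number `2^|D|`
times the `D`-even members of `𝒜` (`card_filter_exists_completion`, `boxFill_injOn`). -/
theorem card_completions {D Λ : Finset (Site 2)} (hD : D ⊆ innerVertices Λ) {𝒜 : Finset (Finset (Site 2))}
    (h𝒜 : 𝒜 ⊆ Λ.powerset) :
    (Λ.powerset.filter fun s => ∃ σ ∈ (fun s => boxFill Λ (fun _ => false) s) '' (↑𝒜 : Set (Finset (Site 2))),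
        (∀ x : Site 2, x ∉ D.image (· + 1) → σ x = boxFill Λ (fun _ => false) s x) ∧ ∀ g ∈ D, ¬ IsOddFace σ g).card =
      2 ^ D.card * (𝒜.filter fun s => ∀ g ∈ D, ¬ IsOddFace (fun x => decide (x ∈ s)) g).card := by
  rw [DefectClosureExploration.EvenLawStub.card_filter_exists_completion hD (fun _ => false)]
  congr 2
  ext s
  simp only [Finset.mem_filter, Finset.mem_powerset, Set.mem_image, Finset.mem_coe]
  constructor
  · rintro ⟨hs, ⟨a, ha, has⟩, hev⟩
    obtain rfl : a = s := boxFill_injOn Λ (fun _ => false) (Finset.mem_coe.2 (h𝒜 ha))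
      (Finset.mem_coe.2 (Finset.mem_powerset.2 hs)) has
    exact ⟨ha, by rwa [boxFill_white_eq hs] at hev⟩
  · rintro ⟨hs𝒜, hev⟩
    have hs : s ⊆ Λ := Finset.mem_powerset.1 (h𝒜 hs𝒜)
    exact ⟨hs, ⟨s, hs𝒜, rfl⟩, by rwa [boxFill_white_eq hs]⟩

/-- THE CODE COUNT, real form: `2^{-|free|} · Π_K |V_K|⁻¹ = (2^|Λ|)⁻¹ · 2^|D|`. -/
theorem quenchedConst_eq {D Λ : Finset (Site 2)} (hD : D ⊆ innerVertices Λ) :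
    ((1 : ℝ) / 2) ^ (freeCells D Λ).card * ∏ K ∈ comps D, 1 / ((localCode D K).card : ℝ) =
      ((2 : ℝ) ^ Λ.card)⁻¹ * 2 ^ D.card := by
  have hR : (2 : ℝ) ^ D.card * (2 ^ (freeCells D Λ).card * ∏ K ∈ comps D, ((localCode D K).card : ℝ)) =
      2 ^ Λ.card := by exact_mod_cast two_pow_mul_codeCard hD
  have hP : (2 : ℝ) ^ (freeCells D Λ).card * ∏ K ∈ comps D, ((localCode D K).card : ℝ) ≠ 0 := by
    intro h0
    rw [h0, mul_zero] at hR
    exact pow_ne_zero _ two_ne_zero hR.symm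
  have hL : ((1 : ℝ) / 2) ^ (freeCells D Λ).card * ∏ K ∈ comps D, 1 / ((localCode D K).card : ℝ) =
      ((2 : ℝ) ^ (freeCells D Λ).card * ∏ K ∈ comps D, ((localCode D K).card : ℝ))⁻¹ := by
    rw [mul_inv, one_div, inv_pow, ← Finset.prod_inv_distrib]
    simp only [one_div]
  rw [hL, ← hR]
  field_simp

/-- RIGHT SIDE, defect set by defect set: `Σ_v envW · quenchedProb v 𝒜 = w_D · (2^|Λ|)⁻¹ · 2^|D| · #{D-even t ∈ 𝒜}`. -/
theorem rhs_term (S : Set ℤ) {D Λ : Finset (Site 2)} (hD : D ⊆ innerVertices Λ) {𝒜 : Finset (Finset (Site 2))}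
    (h𝒜 : 𝒜 ⊆ Λ.powerset) :
    ∑ v ∈ patterns D, envW S Λ D * quenchedProb D Λ v 𝒜 =
      maskDensity tIK ^ D.card * (1 - maskDensity tIK) ^ ((facesIn S Λ).card - D.card) *
        (((2 : ℝ) ^ Λ.card)⁻¹ * (2 ^ D.card * (𝒜.filter fun s => ∀ g ∈ D, ¬ IsOddFace (fun x => decide (x ∈ s)) g).card)) := by
  simp only [quenchedProb, envW]
  rw [← Finset.mul_sum, Finset.sum_comm, mul_assoc]
  congr 1
  rw [Finset.mul_sum]
  have hs : ∀ s ∈ 𝒜, (∏ K ∈ comps D, 1 / (((localCode D K).card : ℝ) - 2)) * ∑ v ∈ patterns D, quenchedW D Λ v s =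
      ((2 : ℝ) ^ Λ.card)⁻¹ * 2 ^ D.card * if ∀ g ∈ D, ¬ IsOddFace (fun x => decide (x ∈ s)) g then 1 else 0 :=
    fun s hs => by
      rw [sum_patterns_quenchedW hD (Finset.mem_powerset.1 (h𝒜 hs)), mul_left_comm, quenchedConst_eq hD, mul_comm]
  rw [Finset.sum_congr rfl hs, ← Finset.mul_sum, Finset.sum_boole, mul_assoc]

end QuenchedMixtureStub

open QuenchedMixtureStub in
/-- **(M) THE EXACT QUENCHED MIXTURE** (`= stub_quenchedMixture`): for every pattern `S`, box `Λ` and family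
`𝒜 ⊆ Λ.powerset` of black sets, the free mixed colour law of `{boxFill Λ white s | s ∈ 𝒜}` is the average over the
colourless environment `(D, v)` (defect set, one pattern per linked component) of the quenched probabilities of `𝒜`. -/
theorem quenchedMixture : QuenchedMixture := by
  intro S Λ 𝒜 h𝒜
  rw [DefectClosureExploration.stub_colourLawMixture S Λ _ (measurableSet_image Λ 𝒜), ENNReal.toReal_sum]
  · refine Finset.sum_congr rfl fun D hD => ?_
    have hDV : D ⊆ innerVertices Λ :=
      (Finset.mem_powerset.1 hD).trans (DefectClosureExploration.facesIn_subset_innerVertices S Λ)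
    have hw : 0 ≤ maskDensity tIK ^ D.card * (1 - maskDensity tIK) ^ ((facesIn S Λ).card - D.card) := by
      obtain ⟨h0, h7⟩ := DefectClosureExploration.subcriticalMaskDensity
      exact mul_nonneg (pow_nonneg h0.le _) (pow_nonneg (by linarith) _)
    rw [card_completions hDV h𝒜, rhs_term S hDV h𝒜, ENNReal.toReal_mul, ENNReal.toReal_mul, ENNReal.toReal_ofReal hw,
      ENNReal.toReal_inv, ENNReal.toReal_pow, ENNReal.toReal_ofNat, ENNReal.toReal_natCast]
    push_cast
    ring
  · intro D _
    exact ENNReal.mul_ne_top ENNReal.ofReal_ne_top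
      (ENNReal.mul_ne_top (ENNReal.inv_ne_top.2 (pow_ne_zero _ two_ne_zero)) (ENNReal.natCast_ne_top _))

/-- **Registered stub `stub_quenchedMixture`** (exact registered signature): the exact quenched mixture (M). -/
theorem stub_quenchedMixture : QuenchedMixture :=
  quenchedMixture

end Summit.CriticalPhenomena.CardyFormulaZ2.Cruxes.IKMixedBoxCrossing.QuenchedChainFKG

end
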